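import Summits.AtomisticToContinuum.Crystallization.Theorems.FrustratedLawDichotomyCellF1Labels

/-!
# FrustratedLawDichotomy · crux `AperiodicFrustratedLawGap` (stmt-AtomisticToContinuum-27623) — class-A K-file skeleton, layer 2d:
the NEAR LISTS of the F1 cell as filtered label lists, and the list-free metric conversions (decomp-a2c hand-2 g47, structural share;
KFILE-FORMAT ed2c §3′ «near lists MN / ML / nb are FILTERED LISTS too — never literals», hand-1 `…CellMasterScale` binders hfarL/hfarD)

For ANY integer radius `ℓ` and centre `c` the (261) near list `ballL MF1 zT ℓ c` of the F1 label set is the `toFinset` of the filtered LIST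
`ballF1 ℓ c := labF1.filter (sqT (· − c) < ℓ)` (kernel-enumerable, no literal; `ballL_MF1_eq`), with `Nodup`, the sum and `∀` bridges, and the
`erase`-of-root variant the doors use (`MN := (ballL M zT ℓ_N 0).erase 0`).  And the METRIC CONVERSIONS every far-label side condition of the (251)
master consumes, specialised to F1's Gershgorin constant `2/5` (layer 1 `t_rows`): a label NOT in the `ℓ`-ball about the root is at distance `≥ L`
from the root / about `c` is at distance `≥ L` from `a c`, for every `F` of the strain cell, whenever `L² ≤ (1 − 3ε)·(2/5)·ℓ` (`far_of_not_mem_ballF1`,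
`dist_of_not_mem_ballF1`).  The dials `ℓ_N, ℓ_D, ℓ_n, ℓ_r` stay free (K-file data).
-/

namespace Summit.AtomisticToContinuum.Crystallization.Theorems.FrustratedLawDichotomyCellF1Lists

open scoped BigOperators
open Summit.AtomisticToContinuum.Crystallization.Theorems.FrustratedLawDichotomyCellMetric (posL)
open Summit.AtomisticToContinuum.Crystallization.Theorems.FrustratedLawDichotomyCellClasses (ballL ballL_subset le_of_not_mem_ballL)
open Summit.AtomisticToContinuum.Crystallization.Theorems.FrustratedLawDichotomyCellTriples (zT sumT sqT subT mem_ballL_zT)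
open Summit.AtomisticToContinuum.Crystallization.Theorems.FrustratedLawDichotomyCellLinSep (le_norm_of_linRadius le_dist_of_linRadius)
open Summit.AtomisticToContinuum.Crystallization.Theorems.FrustratedLawDichotomyCellF1Frame (T t_rows)
open Summit.AtomisticToContinuum.Crystallization.Theorems.FrustratedLawDichotomyCellF1Labels (labF1 MF1 mem_M mem_labF1 labF1_nodup)

/-! ## §1 Near lists as filtered lists -/

/-- the `ℓ`-ball of labels about `c`, as a filtered LIST of the enumerated labels. -/
def ballF1 (ℓ : ℤ) (c : ℤ × ℤ × ℤ) : List (ℤ × ℤ × ℤ) := labF1.filter fun x => decide (sqT (subT x c) < ℓ)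

/-- the same without the centre (the doors' `MN`/`ML` shape `(ballL M zT ℓ 0).erase 0`). -/
def ballF1' (ℓ : ℤ) (c : ℤ × ℤ × ℤ) : List (ℤ × ℤ × ℤ) := labF1.filter fun x => decide (sqT (subT x c) < ℓ ∧ x ≠ c)

/-- membership in the list ball. -/
theorem mem_ballF1 {ℓ : ℤ} {c x : ℤ × ℤ × ℤ} : x ∈ ballF1 ℓ c ↔ x ∈ labF1 ∧ sqT (subT x c) < ℓ := by
  simp [ballF1, List.mem_filter]

/-- membership in the punctured list ball. -/
theorem mem_ballF1' {ℓ : ℤ} {c x : ℤ × ℤ × ℤ} : x ∈ ballF1' ℓ c ↔ x ∈ labF1 ∧ sqT (subT x c) < ℓ ∧ x ≠ c := by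
  simp [ballF1', List.mem_filter]

/-- the list balls have no duplicates. -/
theorem ballF1_nodup (ℓ : ℤ) (c : ℤ × ℤ × ℤ) : (ballF1 ℓ c).Nodup := labF1_nodup.filter _

/-- the punctured list balls have no duplicates. -/
theorem ballF1'_nodup (ℓ : ℤ) (c : ℤ × ℤ × ℤ) : (ballF1' ℓ c).Nodup := labF1_nodup.filter _

/-- ★ the (261) near list of the F1 label set IS the filtered list. -/
theorem ballL_MF1_eq (ℓ : ℤ) (c : ℤ × ℤ × ℤ) : ballL MF1 zT ℓ c = (ballF1 ℓ c).toFinset := by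
  ext x
  simp only [mem_ballL_zT, List.mem_toFinset, mem_ballF1, mem_M, mem_labF1]

/-- ★ the punctured near list `(ballL MF1 zT ℓ c).erase c` IS the punctured filtered list. -/
theorem ballL_MF1_erase_eq (ℓ : ℤ) (c : ℤ × ℤ × ℤ) : (ballL MF1 zT ℓ c).erase c = (ballF1' ℓ c).toFinset := by
  ext x
  simp only [Finset.mem_erase, mem_ballL_zT, List.mem_toFinset, mem_ballF1', mem_M, mem_labF1]
  tauto

/-- sums over a near list are list sums. -/
theorem sum_ballL_MF1 {β : Type*} [AddCommMonoid β] (ℓ : ℤ) (c : ℤ × ℤ × ℤ) (f : ℤ × ℤ × ℤ → β) :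
    ∑ m ∈ ballL MF1 zT ℓ c, f m = ((ballF1 ℓ c).map f).sum := by
  rw [ballL_MF1_eq, List.sum_toFinset _ (ballF1_nodup ℓ c)]

/-- sums over a punctured near list are list sums. -/
theorem sum_ballL_MF1_erase {β : Type*} [AddCommMonoid β] (ℓ : ℤ) (c : ℤ × ℤ × ℤ) (f : ℤ × ℤ × ℤ → β) :
    ∑ m ∈ (ballL MF1 zT ℓ c).erase c, f m = ((ballF1' ℓ c).map f).sum := by
  rw [ballL_MF1_erase_eq, List.sum_toFinset _ (ballF1'_nodup ℓ c)]

/-- `∀` over a near list is a list fact. -/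
theorem forall_ballL_MF1 {ℓ : ℤ} {c : ℤ × ℤ × ℤ} {P : ℤ × ℤ × ℤ → Prop} :
    (∀ m ∈ ballL MF1 zT ℓ c, P m) ↔ ∀ m ∈ ballF1 ℓ c, P m := by
  simp only [ballL_MF1_eq, List.mem_toFinset]

/-- `∀` over a punctured near list is a list fact. -/
theorem forall_ballL_MF1_erase {ℓ : ℤ} {c : ℤ × ℤ × ℤ} {P : ℤ × ℤ × ℤ → Prop} :
    (∀ m ∈ (ballL MF1 zT ℓ c).erase c, P m) ↔ ∀ m ∈ ballF1' ℓ c, P m := by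
  simp only [ballL_MF1_erase_eq, List.mem_toFinset]

/-! ## §2 Metric conversions (list-free; F1's Gershgorin constant `2/5`) -/

/-- ★ a label outside the `ℓ`-ball about the ROOT is at distance `≥ L` from the origin under every `F` of the strain cell, whenever
`L² ≤ (1 − 3ε)·(2/5)·ℓ` (the `hfarL`/`hMNc`/`hMLc` conversions of the master for `MN`/`ML`). -/
theorem far_of_not_mem_ballF1 {F : Matrix (Fin 3) (Fin 3) ℝ} (hG : ∀ i j, |(F.transpose * F) i j - (if i = j then 1 else 0)| ≤ 1 / 1024)
    {L : ℝ} {ℓ : ℤ} (hL : L ^ 2 ≤ (1 - 3 * (1 / 1024)) * (2 / 5) * ℓ) {m : ℤ × ℤ × ℤ} (hm : m ∈ MF1)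
    (hn : m ∉ ballL MF1 zT ℓ (0 : ℤ × ℤ × ℤ)) : L ≤ ‖posL F (T.mulVec fun j => (zT m j : ℝ))‖ := by
  have hz := le_of_not_mem_ballL hm hn
  have h0 : ∀ i, zT (0 : ℤ × ℤ × ℤ) i = 0 := by intro i; fin_cases i <;> rfl
  simp only [h0, sub_zero] at hz
  exact le_norm_of_linRadius hG (by norm_num) T t_rows (by norm_num) hL hz

/-- ★ a label outside the `ℓ`-ball about a label `c` is at distance `≥ L` from `a_F c` (the `nb`/`nbr` side conditions). -/
theorem dist_of_not_mem_ballF1 {F : Matrix (Fin 3) (Fin 3) ℝ} (hG : ∀ i j, |(F.transpose * F) i j - (if i = j then 1 else 0)| ≤ 1 / 1024)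
    {L : ℝ} {ℓ : ℤ} (hL : L ^ 2 ≤ (1 - 3 * (1 / 1024)) * (2 / 5) * ℓ) {c m : ℤ × ℤ × ℤ} (hm : m ∈ MF1) (hn : m ∉ ballL MF1 zT ℓ c) :
    L ≤ dist (posL F (T.mulVec fun j => (zT m j : ℝ))) (posL F (T.mulVec fun j => (zT c j : ℝ))) :=
  le_dist_of_linRadius hG (by norm_num) T t_rows (by norm_num) hL (le_of_not_mem_ballL hm hn)

/-- the radius arithmetic at the dials of the format (sanity, one `norm_num` each): `L = 3 ↦ ℓ = 23`, `L = 5 ↦ ℓ = 63`, `L = 8 ↦ ℓ = 161`. -/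
theorem radii_F1 : (3 : ℝ) ^ 2 ≤ (1 - 3 * (1 / 1024)) * (2 / 5) * (23 : ℤ) ∧ (5 : ℝ) ^ 2 ≤ (1 - 3 * (1 / 1024)) * (2 / 5) * (63 : ℤ) ∧
    (8 : ℝ) ^ 2 ≤ (1 - 3 * (1 / 1024)) * (2 / 5) * (161 : ℤ) := by
  refine ⟨?_, ?_, ?_⟩ <;> push_cast <;> norm_num

end Summit.AtomisticToContinuum.Crystallization.Theorems.FrustratedLawDichotomyCellF1Lists
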